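import Literature.NumberTheory.NumberFields.CMFieldTwoRankOfTotPosSquares
import Literature.Geometry.Kaehler.ComplexTorusRealMultiplicationNarrowClassNumber
import HarnessLib

/-!
# The narrow class number is invariant under field isomorphisms: `F ≃+* F' ⟹ h⁺(F) = h⁺(F')` (proved; no definition, no named fact)

`Proofs`-style file (theorems only) in topic `NumberTheory/NumberFields` (namespace `Literature.NumberTheory.NumberFields`), written by the
prover seat `cruxlead-stmt-BirchSwinnertonDyer-19573-w2` GEN 8 (cell `bsd-2adic`; `--supports` stmt-BirchSwinnertonDyer-19573; closes nothing).
Module (N2) of the seat's «Kida-lite at `ℓ = 2`»: it lets hypotheses on the narrow class numbers of the layers of a `ℤ₂`-tower be moved along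
the ring isomorphisms between the several models of those layers (`(κ|_K)_n ≅ j(K)·F_n ⊆ F̄`, tree `nonempty_ringEquiv_layer_restrict_fieldRange_sup_layer`).
`CMFieldTwoRankOfTotPosSquares.lean` §2 (conv-1) transports `h`, «`h` odd» and «totally positive units are squares» and notes that `h⁺` itself
was left out; here it is, through Fröhlich–Taylor's `h⁺ · #sign(U) = h · 2^{r₁}` (tree `narrowClassNumber_mul_card_unitSignatures`): the three
other quantities transport (`classNumber_eq_of_ringEquiv`; `r₁`; and `#sign(U)` via `ComplexTorus.signVec`, §1), hence so does `h⁺` (§2).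

* §1 (the bijection `σ' ↦ σ' ∘ e` of real embeddings is used inline; no definition) `card_realEmbeddings_eq_of_ringEquiv`, `signVec_unitsMap_mapRingEquiv` (`sign(e u)(σ') = sign(u)(σ' ∘ e)`),
  `card_range_signVec_eq_of_ringEquiv`, `card_unitSignatures_eq_of_ringEquiv`.
* §2 **`narrowClassNumber_eq_of_ringEquiv`**, `padicValNat_narrowClassNumber_eq_of_ringEquiv`.

References: [FrohlichTaylor1990] Ch. V §1 (1.12), p. 164; [Okazaki2000] §3 Lemma 15 (transport context).
-/

set_option autoImplicit false

noncomputable section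

open NumberField

namespace Literature.NumberTheory.NumberFields

open Literature.Geometry.Kaehler Literature.Geometry.Kaehler.ComplexTorus

variable {F F' : Type*} [Field F] [Field F']

/-! ## §1 Real embeddings and unit signatures along `e : F ≃+* F'` -/

/-- `#(F →+* ℝ) = #(F' →+* ℝ)` along `e : F ≃+* F'` (`σ ↦ σ ∘ e⁻¹`). [cite: FrohlichTaylor1990, Ch. V §1, p. 163] -/
theorem card_realEmbeddings_eq_of_ringEquiv [NumberField F] [NumberField F'] (e : F ≃+* F') :
    Fintype.card (F →+* ℝ) = Fintype.card (F' →+* ℝ) := by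
  refine Fintype.card_congr
    { toFun := fun σ ↦ σ.comp e.symm.toRingHom
      invFun := fun σ' ↦ σ'.comp e.toRingHom
      left_inv := fun σ ↦ by ext x; simp
      right_inv := fun σ' ↦ by ext x; simp }

/-- **`sign(e u)(σ') = sign(u)(σ' ∘ e)`**: the signature vector of the transported unit is the signature vector of the unit, relabelled
along `σ' ↦ σ' ∘ e`. [cite: FrohlichTaylor1990, Ch. V §1 (1.10)–(1.12), pp. 163–164] -/
theorem signVec_unitsMap_mapRingEquiv (e : F ≃+* F') (u : (𝓞 F)ˣ) (σ' : F' →+* ℝ) :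
    signVec (Units.map (RingOfIntegers.mapRingEquiv e).toMonoidHom u) σ' = signVec u (σ'.comp e.toRingHom) := by
  rw [signVec_apply, signVec_apply, Units.coe_map]
  change (if σ' ((RingOfIntegers.mapRingEquiv e (u : 𝓞 F) : 𝓞 F') : F') < 0 then (1 : ZMod 2) else 0) = _
  rw [RingOfIntegers.mapRingEquiv_apply]
  rfl

/-- **`#{sign(u) : u ∈ E_F} = #{sign(u') : u' ∈ E_{F'}}`** along `e : F ≃+* F'` (relabel the real embeddings by `σ' ↦ σ' ∘ e`, the units by
`𝓞 F ≅ 𝓞 F'`). [cite: FrohlichTaylor1990, Ch. V §1 (1.12), p. 164] -/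
theorem card_range_signVec_eq_of_ringEquiv (e : F ≃+* F') :
    Nat.card (Set.range (signVec (K := F))) = Nat.card (Set.range (signVec (K := F'))) := by
  classical
  -- relabelling of sign vectors
  let Θ : ((F →+* ℝ) → ZMod 2) → ((F' →+* ℝ) → ZMod 2) := fun v σ' ↦ v (σ'.comp e.toRingHom)
  have hΘinj : Function.Injective Θ := by
    intro v w hvw
    funext σ
    have h := congrFun hvw (σ.comp e.symm.toRingHom)
    have hσ : (σ.comp e.symm.toRingHom).comp e.toRingHom = σ := by ext x; simp
    simpa only [Θ, hσ] using h
  have himage : Θ '' Set.range (signVec (K := F)) = Set.range (signVec (K := F')) := by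
    ext v'
    constructor
    · rintro ⟨_, ⟨u, rfl⟩, rfl⟩
      refine ⟨Units.map (RingOfIntegers.mapRingEquiv e).toMonoidHom u, ?_⟩
      funext σ'
      exact signVec_unitsMap_mapRingEquiv e u σ'
    · rintro ⟨u', rfl⟩
      refine ⟨signVec (Units.map (RingOfIntegers.mapRingEquiv e).symm.toMonoidHom u'), ⟨_, rfl⟩, ?_⟩
      have hback : Units.map (RingOfIntegers.mapRingEquiv e).toMonoidHom
          (Units.map (RingOfIntegers.mapRingEquiv e).symm.toMonoidHom u') = u' := by
        ext; simp
      funext σ'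
      change signVec (Units.map (RingOfIntegers.mapRingEquiv e).symm.toMonoidHom u') (σ'.comp e.toRingHom) = signVec u' σ'
      rw [← signVec_unitsMap_mapRingEquiv e, hback]
  rw [← himage, Nat.card_image_of_injective hΘinj]

/-- **`#sign(E_F) = #sign(E_{F'})`** in the `Kˣ`-bookkeeping of `NarrowClassGroup.lean` (`(unitsRange K).map (signHom K)`).
[cite: FrohlichTaylor1990, Ch. V §1 (1.12), p. 164] -/
theorem card_unitSignatures_eq_of_ringEquiv (e : F ≃+* F') :
    Nat.card ((unitsRange F).map (signHom F)) = Nat.card ((unitsRange F').map (signHom F')) := by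
  rw [card_unitSignatures_eq_card_range_signVec, card_unitSignatures_eq_card_range_signVec, card_range_signVec_eq_of_ringEquiv e]

/-! ## §2 The narrow class number -/

variable [NumberField F] [NumberField F']

/-- **The narrow class number transports along a field isomorphism: `h⁺(F) = h⁺(F')` for `e : F ≃+* F'`** — from
`h⁺ · #sign(U) = h · 2^{r₁}` (Fröhlich–Taylor V (1.12)) on both sides, the class number, `r₁` and `#sign(U)` being invariant (§1) and
`#sign(U) ≠ 0`. [cite: FrohlichTaylor1990, Ch. V §1 (1.12), p. 164] -/
theorem narrowClassNumber_eq_of_ringEquiv (e : F ≃+* F') : narrowClassNumber F = narrowClassNumber F' := by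
  have h1 := narrowClassNumber_mul_card_unitSignatures F
  have h2 := narrowClassNumber_mul_card_unitSignatures F'
  rw [card_unitSignatures_eq_of_ringEquiv e, classNumber_eq_of_ringEquiv e, card_realEmbeddings_eq_of_ringEquiv e, ← h2] at h1
  have hne : Nat.card ((unitsRange F').map (signHom F')) ≠ 0 := by
    intro h0
    rw [h0, mul_zero] at h2
    exact mul_ne_zero (classNumber_pos F').ne' (pow_ne_zero _ two_ne_zero) h2.symm
  exact Nat.eq_of_mul_eq_mul_right (Nat.pos_of_ne_zero hne) h1

/-- `ord_p h⁺(F) = ord_p h⁺(F')` along `e : F ≃+* F'`. [cite: FrohlichTaylor1990, Ch. V §1 (1.12), p. 164] -/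
theorem padicValNat_narrowClassNumber_eq_of_ringEquiv (p : ℕ) (e : F ≃+* F') :
    padicValNat p (narrowClassNumber F) = padicValNat p (narrowClassNumber F') := by
  rw [narrowClassNumber_eq_of_ringEquiv e]

end Literature.NumberTheory.NumberFields

end
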